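import Mathlib
import HarnessLib.Audit
import Summits.PneNP.PneNP.Theorems.PstarGateCaseTSixPin
import Summits.PneNP.PneNP.Theorems.PstarGateCaseTRankSix
import Summits.PneNP.PneNP.Theorems.PstarGateForest
import Summits.PneNP.PneNP.Theorems.PstarNorUnitEQ1Tools
import Summits.PneNP.PneNP.Theorems.PstarGateCaseTSixAffine

/-!
# One GATED chord, CASE T with `q_mv` NOT affine is impossible at rank six (E2 node N4X, high rank; prover-1 g20)

FRONTIER range-avoidance ladder, rung F-N3 (`stmt-PneNP-19007`), cell `pnp-ideate` (`PstarGateNodesX.GateCaseTQuadX`); restricted-model proof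
complexity — nothing here bears on `P` versus `NP`.

CASE T, another chord `e₁` (`D e ∆ D e₁ = {m₀}`, `m₀ = (u, v₀)`), `Q_{D e}` of rank `≥ 6` on `W = coordKer {u}`, `q = q_mv` not affine.
By `PstarGateCaseTSixPin`: `q|H₁ ∈ {0, u_e + 1}` and `q|H₀ ∈ {1, u_e + x_{v₀}}`.  The polar value `polarDir mv` at the AND pair of a
`u`-avoiding edge `a ∈ D e` is computed on four points of either chamber: `0` where `q` is constant, `1` where `q` follows `u_e`; so the
mixed combinations are contradictory, and `(0, 1)` makes `q = x_u + κ₀ + 1` affine.  In the remaining case `q = u_e + 1` on `H₁`,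
`q = u_e + x_{v₀}` on `H₀` (a second other chord `e₂` would give `x_{v₀} = x_{v₀'}`, `m₀ = m₀'`, `e₁ = e₂`), and `q⊥ = q_{(1,0)}` is pinned on
each chamber to `σ₀ + 1` or to `q + σ₀ + 1`-type (`caseT_six_q`, `caseT_six_qperp_zero`).  Minimality at `a` in defect form
(`gate_forest_minimality`): the `mv`-pairing of the value equation reads `q(x) + x_p ℓ(x) = polarDir mv (e_{a₂}, e_{a₃}) = 1`; in `H₁` this
forces `u_e(x) = 1`, `x_p = 1`, `x_{p'} = 0`, in `H₀` it forces `q(x) = 1`, `u_{e₁}(x) = 0`; either way `e₁` is OFF with both privates `1`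
and the second coordinate reads `q⊥(x) = [a ∈ T₂] + σ₀`, while `[a ∈ T₂] = polarDir (1,0)(e_{a₂}, e_{a₃})` is `0` in the constant regime
(where `q⊥(x) = σ₀ + 1`) and `1` in the other (where `q⊥(x) = σ₀`):

* `caseT_six_false_quad` — **contradiction.**
-/

set_option linter.dupNamespace false -- `Summit.PneNP.PneNP.…`: summit = sub-problem name (D-0017 single-conjunct layout)

open Finset Module Literature.Computability.Complexity
open scoped symmDiff
open Summit.PneNP.PneNP.Theorems.PstarFibrePolys (bit)
open Summit.PneNP.PneNP.Theorems.PstarTyped (Typed)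
open Summit.PneNP.PneNP.Theorems.PstarSALevel (BoundaryExpanding SimpleOverlap)
open Summit.PneNP.PneNP.Theorems.PstarCubeIdeals (IsAffineFn)
open Summit.PneNP.PneNP.Theorems.PstarProductRank (qform polar)
open Summit.PneNP.PneNP.Theorems.PstarQuadRank (rad)
open Summit.PneNP.PneNP.Theorems.PstarPathRank (AndAdj polar_basis andPair_ne)
open Summit.PneNP.PneNP.Theorems.PstarPathRankFibre (coordKer mem_coordKer avoid)
open Summit.PneNP.PneNP.Theorems.PstarReadSumset (V2)
open Summit.PneNP.PneNP.Theorems.PstarChordSystem (ChordSystem)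
open Summit.PneNP.PneNP.Theorems.PstarChordSystemMap (omega)
open Summit.PneNP.PneNP.Theorems.PstarChordBridgeTools (privs coef vars_mem_privs)
open Summit.PneNP.PneNP.Theorems.PstarChordBridge (BridgeData sys Solution Lift)
open Summit.PneNP.PneNP.Theorems.PstarChordBridgeForcing (gam sys_u_eq)
open Summit.PneNP.PneNP.Theorems.PstarChordBridgeBasis (qDir polarDir)
open Summit.PneNP.PneNP.Theorems.PstarChordBridgeCorner (qDir_add omega_F omega_add_left omega_smul andAdj_iff_mem)
open Summit.PneNP.PneNP.Theorems.PstarChordBridgeForest (defect_eq_one)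
open Summit.PneNP.PneNP.Theorems.PstarChordBridgeFundamental (eq_of_fundamental_eq)
open Summit.PneNP.PneNP.Theorems.PstarGateBridge (GateHyp const_of_others gate_reads)
open Summit.PneNP.PneNP.Theorems.PstarGateForest (gate_forest_minimality)
open Summit.PneNP.PneNP.Theorems.PstarGateCaseTLocal (u_add)
open Summit.PneNP.PneNP.Theorems.PstarNorUnitEQ1Tools (polarDir_single_pair)
open Summit.PneNP.PneNP.Theorems.PstarGateFibreRank (avoid_nonempty)
open Summit.PneNP.PneNP.Theorems.PstarGateNodes (GateData)
open Summit.PneNP.PneNP.Theorems.PstarGateNodesX (GateDataX)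
open Summit.PneNP.PneNP.Theorems.PstarGateCaseTRankSix (sigma_const caseT_six_q)
open Summit.PneNP.PneNP.Theorems.PstarGateCaseTSixAffine (omega_sum)
open Summit.PneNP.PneNP.Theorems.PstarGateCaseTPairExc (caseT_coupled)
open Summit.PneNP.PneNP.Theorems.PstarGateCaseTStructure (caseT_through caseT_diff_single)
open Summit.PneNP.PneNP.Theorems.PstarGateCaseTSixPin (u_other_eq caseT_six_pin_one caseT_six_pin_zero caseT_six_qperp_zero)

namespace Summit.PneNP.PneNP.Theorems.PstarGateCaseTSixQuad

variable {n m : ℕ}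

/-- Second differences of a quadratic function along two directions. -/
private theorem quad_two {q : (Fin n → ZMod 2) → ZMod 2} {Bf : LinearMap.BilinForm (ZMod 2) (Fin n → ZMod 2)}
    (hq : ∀ x w, q (x + w) = q x + q w + q 0 + Bf x w) (y v w : Fin n → ZMod 2) :
    q (y + v + w) = q (y + v) + q (y + w) + q y + Bf v w := by
  have h1 := hq (y + v) w
  have h2 := hq y w
  rw [map_add, LinearMap.add_apply] at h1
  rw [h1, h2]
  generalize q (y + v) = a; generalize q y = b; generalize q w = c; generalize q 0 = d; generalize Bf y w = s; generalize Bf v w = t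
  revert a b c d s t; decide

/-- **N4X at rank six is contradictory.**  See the module docstring. -/
theorem caseT_six_false_quad (I : LocalMap 4 n m) (hI : I.IsPure xorAndPred) (hT : Typed I) (hS : SimpleOverlap I) {r₀ : ℕ}
    (hB : BoundaryExpanding r₀ I) {B : BridgeData n m} {e g₀ : Fin m} {u : Fin n} {κ₀ : ZMod 2} (hD : GateDataX I r₀ B e g₀ u κ₀)
    {mv : V2} (hmvT : mv = (0, 1) ∨ mv = (1, 1))
    (hP : ∀ e' ∈ B.N, e' ≠ e → ∀ a, ((sys I B).ρ e' a = 0 ∨ (sys I B).ρ e' a = mv) ∧ ((sys I B).ρ' e' a = 0 ∨ (sys I B).ρ' e' a = mv))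
    (hread : ∀ e' ∈ B.N, e' ≠ e → ∀ a, (sys I B).ρ e' a ≠ 0 ∨ (sys I B).ρ' e' a ≠ 0) (hN : (B.N.erase e).Nonempty)
    (hq : ¬ IsAffineFn (qDir I B mv))
    (h6 : finrank (ZMod 2) (rad ((polar (B.D e) (fun j => I.vars j 2) (fun j => I.vars j 3)).restrict (coordKer ({u} : Finset (Fin n))))) + 6 ≤
      finrank (ZMod 2) (coordKer ({u} : Finset (Fin n)))) : False := by
  classical
  obtain ⟨hXc, hW, hr, hd₁, hd₂, hL, -, -, hG, hg₀, hgv, -, hup, hux, hG₁p, hcoef, hT3, hM0⟩ := id hD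
  have he : e ∈ B.N := hG.1
  have heD : e ∉ B.D e := fun h => (mem_sdiff.1 (hW.hD e he h)).2 he
  obtain ⟨e₁, he₁⟩ := hN
  obtain ⟨hne₁, he₁N⟩ := mem_erase.1 he₁
  obtain ⟨hthr₁, hκ⟩ := caseT_through I hI hT hS hB hD hmvT hP hread he₁N hne₁
  -- the `u`-edge `m₀ = (u, v₀)` of `e₁`
  have hv₀ex : ∀ {c : Fin m}, c ∈ B.N → c ≠ e → ∃ m₀ v₀, B.D e ∆ B.D c = {m₀} ∧ v₀ ≠ u ∧
      ((I.vars m₀ 2 = u ∧ I.vars m₀ 3 = v₀) ∨ (I.vars m₀ 2 = v₀ ∧ I.vars m₀ 3 = u)) := by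
    intro c hc hce
    obtain ⟨m₀, hm₀, hm₀u, -⟩ := caseT_diff_single I hI hT hS hB hD hmvT hP hread hc hce
    have h23 : I.vars m₀ 2 ≠ I.vars m₀ 3 := fun h => absurd (hI.2 m₀ h) (by decide)
    rcases hm₀u with h2 | h3
    · exact ⟨m₀, I.vars m₀ 3, hm₀, fun h => h23 (h2.trans h.symm), Or.inl ⟨h2, rfl⟩⟩
    · exact ⟨m₀, I.vars m₀ 2, hm₀, fun h => h23 (h.trans h3.symm), Or.inr ⟨rfl, h3⟩⟩
  obtain ⟨m₀, v₀, hm₀, hv₀u, hv₀⟩ := hv₀ex he₁N hne₁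
  have hsub := u_other_eq I hI hT hS hB hD hmvT hP hread he₁N hne₁ hm₀ hv₀
  set σ₀ := ∑ i ∈ B.N.erase e, (((sys I B).ρ i 0).2 + ((sys I B).ρ' i 0).2) with hσ₀
  -- an avoiding edge `a` of `D e` and the four-point evaluations of polar values on either chamber
  obtain ⟨a, ha⟩ := avoid_nonempty I hI hS heD (hW.hDeven e he) u
  unfold PstarPathRankFibre.avoid at ha
  obtain ⟨haD, ha2, ha3⟩ := mem_filter.1 ha
  rw [mem_singleton] at ha2 ha3
  have haJ : a ∈ B.J₀ := (mem_sdiff.1 (hW.hD e he haD)).1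
  set va : Fin n → ZMod 2 := Pi.single (I.vars a 2) 1 with hva
  set wa : Fin n → ZMod 2 := Pi.single (I.vars a 3) 1 with hwa
  have hvau : va u = 0 := by rw [hva, Pi.single_eq_of_ne (Ne.symm ha2)]
  have hwau : wa u = 0 := by rw [hwa, Pi.single_eq_of_ne (Ne.symm ha3)]
  have hab : polar (B.D e) (fun j => I.vars j 2) (fun j => I.vars j 3) va wa = 1 := by
    rw [hva, hwa, polar_basis I hI hS, if_pos ((andAdj_iff_mem I hI hS (B.D e) a).2 haD)]
  -- four points `y, y+va, y+wa, y+va+wa` in one chamber: the polar value from the chamber formula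
  have four_const : ∀ (Q : (Fin n → ZMod 2) → ZMod 2) (Bq : LinearMap.BilinForm (ZMod 2) (Fin n → ZMod 2))
      (hQ : ∀ x w, Q (x + w) = Q x + Q w + Q 0 + Bq x w) (c k : ZMod 2),
      (∀ x : Fin n → ZMod 2, x u = c → Q x = k) → Bq va wa = 0 := by
    intro Q Bq hQ c k hc
    set y : Fin n → ZMod 2 := Pi.single u c with hy
    have hyu : y u = c := by rw [hy, Pi.single_eq_same]
    have h := quad_two hQ y va wa
    rw [hc _ (by rw [Pi.add_apply, Pi.add_apply, hyu, hvau, hwau, add_zero, add_zero]), hc _ (by rw [Pi.add_apply, hyu, hvau, add_zero]),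
      hc _ (by rw [Pi.add_apply, hyu, hwau, add_zero]), hc _ hyu] at h
    have e2 : ∀ s k' : ZMod 2, k' = k' + k' + k' + s → s = 0 := by decide
    exact e2 _ _ h
  have four_lin : ∀ (Q : (Fin n → ZMod 2) → ZMod 2) (Bq : LinearMap.BilinForm (ZMod 2) (Fin n → ZMod 2))
      (hQ : ∀ x w, Q (x + w) = Q x + Q w + Q 0 + Bq x w) (c k : ZMod 2) (L : (Fin n → ZMod 2) →ₗ[ZMod 2] ZMod 2),
      (∀ x : Fin n → ZMod 2, x u = c → Q x = (sys I B).u e x + L x + k) → Bq va wa = 1 := by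
    intro Q Bq hQ c k L hc
    set y : Fin n → ZMod 2 := Pi.single u c with hy
    have hyu : y u = c := by rw [hy, Pi.single_eq_same]
    have h := quad_two hQ y va wa
    have hU := quad_two (u_add I B e) y va wa
    rw [hab] at hU
    rw [hc _ (by rw [Pi.add_apply, Pi.add_apply, hyu, hvau, hwau, add_zero, add_zero]), hc _ (by rw [Pi.add_apply, hyu, hvau, add_zero]),
      hc _ (by rw [Pi.add_apply, hyu, hwau, add_zero]), hc _ hyu, hU, map_add, map_add, map_add] at h
    clear hc
    revert h
    generalize (sys I B).u e (y + va) = p; generalize (sys I B).u e (y + wa) = p'; generalize (sys I B).u e y = p''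
    generalize Bq va wa = s; generalize L y = l; generalize L va = l'; generalize L wa = l''
    revert p p' p'' s l l' l'' k; decide
  -- the chamber pins
  have hH1 := caseT_six_pin_one I hI hT hS hB hD hmvT hP hread ⟨e₁, he₁⟩ h6
  have hH0 := caseT_six_pin_zero I hI hT hS hB hD hmvT hP hread he₁N hne₁ hm₀ hv₀ h6
  -- the polar value of `q` at the pair of `a`, from each chamber
  have hτ1 : (∀ x : Fin n → ZMod 2, x u = κ₀ + 1 → qDir I B mv x = (sys I B).u e x + 1) → polarDir I B mv va wa = 1 := fun h =>
    four_lin _ _ (qDir_add I B mv) (κ₀ + 1) 1 0 fun x hx => by rw [h x hx, LinearMap.zero_apply, add_zero]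
  have hτ0 : (∀ x : Fin n → ZMod 2, x u = κ₀ → qDir I B mv x = (sys I B).u e x + x v₀) → polarDir I B mv va wa = 1 := fun h =>
    four_lin _ _ (qDir_add I B mv) κ₀ 0 (LinearMap.proj v₀) fun x hx => by rw [h x hx, LinearMap.proj_apply, add_zero]
  rcases hH1 with h1l | h1r
  · rcases hH0 with h0l | h0r
    · -- `q = x_u + κ₀ + 1`: affine
      refine hq fun x w => ?_
      have hqx : ∀ x : Fin n → ZMod 2, qDir I B mv x = x u + κ₀ + 1 := by
        intro x
        have hc : ∀ t k : ZMod 2, t = k ∨ t = k + 1 := by decide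
        rcases hc (x u) κ₀ with h | h
        · rw [h0l x h, h]; generalize κ₀ = k; revert k; decide
        · rw [h1l x h, h]; generalize κ₀ = k; revert k; decide
      simp only [hqx, Pi.add_apply, Pi.zero_apply]
      have e3 : ∀ s t k : ZMod 2, s + t + k + 1 = s + k + 1 + (t + k + 1) + (0 + k + 1) := by decide
      exact e3 _ _ _
    · have h0 := four_const _ _ (qDir_add I B mv) (κ₀ + 1) 0 h1l
      rw [hτ0 h0r] at h0
      exact one_ne_zero h0
  rcases hH0 with h0l | h0r
  · have h0 := four_const _ _ (qDir_add I B mv) κ₀ 1 h0l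
    rw [hτ1 h1r] at h0
    exact one_ne_zero h0
  -- MAIN CASE: `q = u_e + 1` on `H₁`, `q = u_e + x_{v₀}` on `H₀`.  First: no second other chord.
  have hN1 : ∀ c ∈ B.N.erase e, c = e₁ := by
    intro c hc
    obtain ⟨hce, hcN⟩ := mem_erase.1 hc
    by_contra hc₁
    obtain ⟨m₀', v₀', hm₀', hv₀'u, hv₀'⟩ := hv₀ex hcN hce
    rcases caseT_six_pin_zero I hI hT hS hB hD hmvT hP hread hcN hce hm₀' hv₀' h6 with h0l' | h0r'
    · have h0 := four_const _ _ (qDir_add I B mv) κ₀ 1 h0l'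
      rw [hτ1 h1r] at h0
      exact one_ne_zero h0
    · -- `x_{v₀} = x_{v₀'}` on `H₀`, so `v₀ = v₀'`, `m₀ = m₀'`, `D c = D e₁`, `c = e₁`
      set y : Fin n → ZMod 2 := Pi.single u κ₀ + Pi.single v₀ 1 with hy
      have hyu : y u = κ₀ := by rw [hy, Pi.add_apply, Pi.single_eq_same, Pi.single_eq_of_ne (Ne.symm hv₀u), add_zero]
      have h := (h0r y hyu).symm.trans (h0r' y hyu)
      have hvv : v₀' = v₀ := by
        by_contra hne
        rw [hy, Pi.add_apply, Pi.add_apply, Pi.single_eq_of_ne hv₀u, Pi.single_eq_same, Pi.single_eq_of_ne hv₀'u,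
          Pi.single_eq_of_ne hne] at h
        revert h; generalize (sys I B).u e (Pi.single u κ₀ + Pi.single v₀ 1) = t; revert t; decide
      subst hvv
      have hmm : m₀ = m₀' := by
        by_contra hne
        refine andPair_ne I hI hS hne ?_
        rcases hv₀ with ⟨h2, h3⟩ | ⟨h2, h3⟩ <;> rcases hv₀' with ⟨h2', h3'⟩ | ⟨h2', h3'⟩
        · exact Or.inl ⟨h2.trans h2'.symm, h3.trans h3'.symm⟩
        · exact Or.inr ⟨h2.trans h3'.symm, h3.trans h2'.symm⟩
        · exact Or.inr ⟨h2.trans h3'.symm, h3.trans h2'.symm⟩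
        · exact Or.inl ⟨h2.trans h2'.symm, h3.trans h3'.symm⟩
      subst hmm
      have hDD : B.D e₁ = B.D c := by
        have h1 : B.D e₁ = B.D e ∆ {m₀} := by rw [← hm₀, ← symmDiff_assoc, symmDiff_self, bot_symmDiff]
        have h2 : B.D c = B.D e ∆ {m₀} := by rw [← hm₀', ← symmDiff_assoc, symmDiff_self, bot_symmDiff]
        rw [h1, h2]
      have h1D : e₁ ∉ B.D e₁ := fun h => (mem_sdiff.1 (hW.hD e₁ he₁N h)).2 he₁N
      have hcD : c ∉ B.D e₁ := fun h => (mem_sdiff.1 (hW.hD e₁ he₁N h)).2 hcN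
      have hev' : ∀ w, Even (PstarChordBridgeTools.xpdeg I (insert c (B.D e₁)) w) := fun w => by rw [hDD]; exact hW.hDeven c hcN w
      exact hc₁ (eq_of_fundamental_eq I hI hS h1D hcD (hW.hDeven e₁ he₁N) hev').symm
  have hσ₁ : σ₀ = ((sys I B).ρ e₁ 0).2 + ((sys I B).ρ' e₁ 0).2 := by
    have hNe : B.N.erase e = {e₁} := eq_singleton_iff_unique_mem.2 ⟨he₁, hN1⟩
    rw [hσ₀, hNe, sum_singleton]
  have hτ : polarDir I B mv va wa = 1 := hτ1 h1r
  -- the `q⊥` pins and the value of `[a ∈ T₂]` in each chamber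
  have hq6 := caseT_six_q I hI hT hD hmvT hP hread h6
  have hq0 := caseT_six_qperp_zero I hI hT hD hmvT hP hread hv₀u h0r h6
  have hT₂ : polarDir I B (1, 0) va wa = if a ∈ B.T₂ then 1 else 0 := by
    have h := polarDir_single_pair I hI hS hd₁ hd₂ (1, 0) haJ
    simp only [zero_mul, zero_add, one_mul] at h
    exact h
  -- (M0) at `a`, defect form
  have haDc : a ∈ B.D e₁ := by
    by_contra hna
    rcases hthr₁ a (Finset.mem_symmDiff.2 (Or.inl ⟨haD, hna⟩)) with h | h
    · exact ha2 h
    · exact ha3 h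
  obtain ⟨z, hz⟩ := hM0 a haJ
  have hpp' : I.vars e 2 ≠ I.vars e 3 := fun h => absurd (hI.2 e h) (by decide)
  have hp'priv : I.vars e 3 ∈ privs I B.N := vars_mem_privs I he (s := 3) (by decide)
  obtain ⟨hunG₁, hunG₂⟩ := hG.2.1 _ hp'priv (Ne.symm hpp')
  have hG₁'' : ∀ g ∈ B.G₁.erase g₀, I.vars g 2 ≠ I.vars e 2 ∧ I.vars g 2 ≠ I.vars e 3 ∧ I.vars g 3 ≠ I.vars e 2 ∧ I.vars g 3 ≠ I.vars e 3 :=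
    fun g hg => ⟨(hG₁p g hg).1, (hunG₁ g (mem_of_mem_erase hg)).1, (hG₁p g hg).2, (hunG₁ g (mem_of_mem_erase hg)).2⟩
  have hG₂'' : ∀ g ∈ B.G₂, I.vars g 2 ≠ I.vars e 2 ∧ I.vars g 2 ≠ I.vars e 3 ∧ I.vars g 3 ≠ I.vars e 2 ∧ I.vars g 3 ≠ I.vars e 3 :=
    fun g hg => ⟨(hG.2.2.1 g hg).1, (hunG₂ g hg).1, (hG.2.2.1 g hg).2, (hunG₂ g hg).2⟩
  obtain ⟨hchord, hval⟩ := gate_forest_minimality I hI hT hW he haD hg₀ hgv hup hG₁'' hG₂'' hz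
  have hδ := defect_eq_one I hI hW he haD hT3 hz
  set x : Fin n → ZMod 2 := fun v => bit (z v) with hxdef
  set st : Fin m → ZMod 2 × ZMod 2 := fun c => (bit (z (I.vars c 2)), bit (z (I.vars c 3))) with hst
  rw [hδ] at hval
  -- the `mv`-pairing: `q(x) + x_p ℓ(x) = polarDir mv (va, wa) = 1`
  have hωval := congrArg (fun v => omega v mv) hval
  unfold ChordSystem.val at hωval
  rw [omega_add_left, omega_add_left, omega_sum, ← add_sum_erase B.N _ he] at hωval
  have hmv2 : mv.2 = 1 := by rcases hmvT with h | h <;> rw [h]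
  have hωe : omega ((sys I B).contrib x st e) mv = bit (z (I.vars e 2)) * coef I B.C₁ B.G₁ (I.vars e 2) x := by
    unfold ChordSystem.contrib
    rw [(gate_reads I hI hG x).1, (gate_reads I hI hG x).2, smul_zero, add_zero, omega_smul]
    show bit (z (I.vars e 2)) * omega (coef I B.C₁ B.G₁ (I.vars e 2) x, 0) mv = _
    unfold omega
    rw [hmv2]; ring
  have hωc : ∀ c ∈ B.N.erase e, omega ((sys I B).contrib x st c) mv = 0 := by
    intro c hc
    obtain ⟨hne', hcN⟩ := mem_erase.1 hc
    unfold ChordSystem.contrib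
    rw [omega_add_left, omega_smul, omega_smul]
    have hω0 : ∀ y : V2, (y = 0 ∨ y = mv) → omega y mv = 0 := by
      intro y hy
      rcases hy with hy | hy <;> rw [hy] <;> unfold omega
      · simp
      · rw [mul_comm mv.2 mv.1]; exact CharTwo.add_self_eq_zero _
    show (st c).1 * omega ((sys I B).ρ c x) mv + (st c).2 * omega ((sys I B).ρ' c x) mv = 0
    rw [hω0 _ (hP c hcN hne' x).1, hω0 _ (hP c hcN hne' x).2, mul_zero, mul_zero, add_zero]
  rw [sum_eq_zero hωc, add_zero, hωe] at hωval
  have hωτ : omega ((if a ∈ B.T₁ then (1 : ZMod 2) else 0), (if a ∈ B.T₂ then (1 : ZMod 2) else 0)) mv = 1 := by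
    have h : omega ((if a ∈ B.T₁ then (1 : ZMod 2) else 0), (if a ∈ B.T₂ then (1 : ZMod 2) else 0)) mv = polarDir I B mv va wa := by
      rw [hva, hwa, polarDir_single_pair I hI hS hd₁ hd₂ mv haJ]
      unfold omega; ring
    rw [h, hτ]
  rw [hωτ] at hωval
  have hmain : qDir I B mv x + bit (z (I.vars e 2)) * coef I B.C₁ B.G₁ (I.vars e 2) x = 1 := by
    rw [← omega_F, omega_add_left]
    have e2 : ∀ f c t : ZMod 2, f + c = t + 1 → f + t + c = 1 := by decide
    exact e2 _ _ _ hωval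
  -- the second coordinate: `q⊥(x) = [a ∈ T₂] + (reads of e₁ weighted by its states)`
  have h2 := congrArg Prod.snd hval
  unfold ChordSystem.val at h2
  rw [Prod.snd_add, Prod.snd_add, Prod.snd_sum, ← add_sum_erase B.N _ he] at h2
  have h2e : ((sys I B).contrib x st e).2 = 0 := by
    unfold ChordSystem.contrib
    rw [(gate_reads I hI hG x).1, (gate_reads I hI hG x).2, smul_zero, add_zero, Prod.smul_snd, smul_eq_mul, mul_zero]
  rw [h2e, zero_add] at h2
  -- if `e₁` is OFF with both privates `1`, the reads are `σ₀`
  have hq2_of : bit (z (I.vars e₁ 2)) = 1 → bit (z (I.vars e₁ 3)) = 1 → qDir I B (1, 0) x = (if a ∈ B.T₂ then 1 else 0) + σ₀ := by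
    intro h1 h1'
    have h2c : ∀ c ∈ B.N.erase e, ((sys I B).contrib x st c).2 = ((sys I B).ρ c x).2 + ((sys I B).ρ' c x).2 := by
      intro c hc
      have hc₁ := hN1 c hc
      subst hc₁
      unfold ChordSystem.contrib
      rw [Prod.snd_add, Prod.smul_snd, Prod.smul_snd, smul_eq_mul, smul_eq_mul]
      show bit (z (I.vars c 2)) * _ + bit (z (I.vars c 3)) * _ = _
      rw [h1, h1', one_mul, one_mul]
    have h2' := h2
    rw [sum_congr rfl h2c, sigma_const I hW hG x] at h2'
    unfold PstarChordBridgeBasis.qDir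
    simp only [zero_mul, one_mul, zero_add]
    have e3 : ∀ F s t τ : ZMod 2, F + s = t + τ → F + t = τ + s := by decide
    exact e3 _ _ _ _ h2'
  have hprod₁ : bit (z (I.vars e₁ 2)) * bit (z (I.vars e₁ 3)) = (sys I B).u e₁ x + 1 := by
    have h := hchord e₁ he₁N hne₁
    rw [if_pos haDc, hδ] at h
    exact h
  have ones_of : (sys I B).u e₁ x = 0 → bit (z (I.vars e₁ 2)) = 1 ∧ bit (z (I.vars e₁ 3)) = 1 := by
    intro h0
    rw [h0, zero_add] at hprod₁
    have e2 : ∀ s t : ZMod 2, s * t = 1 → s = 1 ∧ t = 1 := by decide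
    exact e2 _ _ hprod₁
  -- chamber split of the witness
  have hc : ∀ t k : ZMod 2, t = k + 1 ∨ t = k := by decide
  rcases hc (x u) κ₀ with hx1 | hx0
  · -- `x ∈ H₁`: `q(x) = u_e(x) + 1`, `ℓ = 1`
    have hl : coef I B.C₁ B.G₁ (I.vars e 2) x = 1 := by
      rw [hcoef, hx1]; generalize κ₀ = k; revert k; decide
    rw [hl, mul_one, h1r x hx1] at hmain
    -- `x_p = u_e(x)`; then `u_e(x) = 1`, by the defect
    have hue : (sys I B).u e x = 1 := by
      have e2 : ∀ U p p' : ZMod 2, U + 1 + p = 1 → U + p * p' = 1 → U = 1 := by decide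
      exact e2 _ _ _ hmain hδ
    have hu₁ : (sys I B).u e₁ x = 0 := by
      rw [caseT_coupled I hI hT hS hB hD hmvT he₁N hne₁ (hP e₁ he₁N hne₁) (hread e₁ he₁N hne₁) x hx1, hue]; decide
    obtain ⟨h1, h1'⟩ := ones_of hu₁
    have hq2 := hq2_of h1 h1'
    rcases hq6 with hcst | heq
    · have hB0 := four_const _ _ (qDir_add I B (1, 0)) (κ₀ + 1) (1 + σ₀) hcst
      rw [hT₂] at hB0
      rw [hcst x hx1, hB0, zero_add] at hq2
      have e2 : ∀ k : ZMod 2, 1 + k ≠ k := by decide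
      exact e2 _ hq2
    · have hB1 := four_lin _ _ (qDir_add I B (1, 0)) (κ₀ + 1) (σ₀ + 1) 0 fun y hy => by rw [heq y hy, LinearMap.zero_apply, add_zero, add_assoc]
      rw [hT₂] at hB1
      rw [heq x hx1, hue, hB1] at hq2
      have e2 : ∀ k : ZMod 2, 1 + k + 1 ≠ 1 + k := by decide
      exact e2 _ hq2
  · -- `x ∈ H₀`: `ℓ = 0`, so `q(x) = 1 = u_e(x) + x_{v₀}`, and `u_{e₁}(x) = 0`
    have hl : coef I B.C₁ B.G₁ (I.vars e 2) x = 0 := by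
      rw [hcoef, hx0]; exact CharTwo.add_self_eq_zero κ₀
    rw [hl, mul_zero, add_zero] at hmain
    have hUv : (sys I B).u e x + x v₀ = 1 := by rw [← h0r x hx0]; exact hmain
    have hu₁ : (sys I B).u e₁ x = 0 := by
      rw [hsub x, hx0, hκ, one_mul]
      revert hUv; generalize (sys I B).u e x = U; generalize x v₀ = t; revert U t; decide
    obtain ⟨h1, h1'⟩ := ones_of hu₁
    have hq2 := hq2_of h1 h1'
    rcases hq0 with hcst | heq
    · have hB0 := four_const _ _ (qDir_add I B (1, 0)) κ₀ (1 + σ₀) hcst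
      rw [hT₂] at hB0
      rw [hcst x hx0, hB0, zero_add] at hq2
      have e2 : ∀ k : ZMod 2, 1 + k ≠ k := by decide
      exact e2 _ hq2
    · have hB1 := four_lin _ _ (qDir_add I B (1, 0)) κ₀ (σ₀ + 1) (LinearMap.proj v₀) fun y hy => by
        rw [heq y hy, LinearMap.proj_apply, add_assoc]
      rw [hT₂] at hB1
      rw [heq x hx0, hB1] at hq2
      rw [hUv] at hq2
      have e2 : ∀ k : ZMod 2, 1 + k + 1 ≠ 1 + k := by decide
      exact e2 _ hq2

end Summit.PneNP.PneNP.Theorems.PstarGateCaseTSixQuad
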